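import Summits.AnomalousDissipation.AnomalousDissipation.Theses.DebrisQuanta
import Literature.Analysis.FluidPDE.LerayHopfRestartTorus

/-!
# Strategist sketch — crux `RecurrentDebris` (stmt-AnomalousDissipation-2858, route DebrisQuanta)

Typed statements quoted in `STRATEGY-CENSUS.md` and in the negation-lens crux idea
`debris-enstrophy-floor`. Nothing here is proposed to the tree; every `def` is a `Prop` over
existing declarations and must elaborate (`lean check` rc 0, no `sorry`).

Abbreviations (the crux's own inline `let`s, copied verbatim): `D α W` = the truncated homogeneous
cusp `curl[χ(|z|)|z|^{1−α} W(z/|z|)]` centred at `(½,½,½)`; `Adm α W`; `Bg M b` (calm background);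
`Good ν f u t₀` (energy inequality from `t₀`); `tol α c ν = c·ν^{(3−2α)/(2(1−α))}`.
-/

set_option linter.dupNamespace false

noncomputable section

open Filter Set MeasureTheory Topology

namespace Summit.AnomalousDissipation.AnomalousDissipation.Cruxes.RecurrentDebris.Strategist

local notation "𝕋³" => UnitAddTorus (Fin 3)
local notation "E³" => EuclideanSpace ℝ (Fin 3)

/-- The crux's debris profile `D_{α,W}` (verbatim copy of the route's inline `let D`). -/
def D (α : ℝ) (W : E³ → E³) (x : 𝕋³) : E³ :=
  Literature.Analysis.FluidPDE.curl
    (fun z : E³ => (Real.smoothTransition (2 - 8 * ‖z‖) * ‖z‖ ^ (1 - α)) • W (‖z‖⁻¹ • z))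
    (Literature.Analysis.FunctionSpaces.Torus.repr x - (!₂[(1:ℝ)/2, 1/2, 1/2] : E³))

/-- Admissible profile potential (verbatim copy of the route's inline `let Adm`). -/
def Adm (α : ℝ) (W : E³ → E³) : Prop :=
  ContDiff ℝ ((⊤ : ℕ∞) : WithTop ℕ∞) W ∧ ∃ y : E³, y ≠ 0 ∧
    Literature.Analysis.FluidPDE.curl (fun z : E³ => (‖z‖ ^ (1 - α)) • W (‖z‖⁻¹ • z)) y ≠ 0

/-- Calm background of size `M` (verbatim copy of the route's inline `let Bg`). -/
def Bg (M : ℝ) (b : 𝕋³ → E³) : Prop :=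
  Literature.Analysis.FunctionSpaces.Torus.IsSmooth b ∧ Literature.Analysis.FunctionSpaces.Torus.IsDivFree b ∧
    ∀ y : E³, ‖Literature.Analysis.FunctionSpaces.Torus.lift b y‖ ≤ M ∧
      ‖fderiv ℝ (Literature.Analysis.FunctionSpaces.Torus.lift b) y‖ ≤ M

/-- Energy inequality from `t₀` (verbatim copy of the route's inline `let Good`). -/
def Good (ν : ℝ) (f : 𝕋³ → E³) (u : ℝ → 𝕋³ → E³) (t₀ : ℝ) : Prop :=
  ∀ t : ℝ, t₀ ≤ t →
    Literature.Analysis.FunctionSpaces.Torus.kineticEnergy (u t) +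
        ν * (∫⁻ s in Set.Ioo t₀ t, Literature.Analysis.FunctionSpaces.Torus.eGradNormSq (u s)).toReal ≤
      Literature.Analysis.FunctionSpaces.Torus.kineticEnergy (u t₀) + ∫ s in t₀..t, ∫ x, inner ℝ (f x) (u s x)

/-- The debris tolerance `c·ν^{(3−2α)/(2(1−α))}` as an extended real. -/
def tol (α c ν : ℝ) : ENNReal := ENNReal.ofReal (c * ν ^ ((3 - 2 * α) / (2 * (1 - α))))

/-- `v` is a debris state at viscosity `ν`: within tolerance of `b + D(· − a)` for some collapse
point `a` and calm background `b` of size `M`. -/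
def IsDebrisState (α : ℝ) (W : E³ → E³) (M c ν : ℝ) (v : 𝕋³ → E³) : Prop :=
  ∃ (a : 𝕋³) (b : 𝕋³ → E³), Bg M b ∧
    MeasureTheory.eLpNorm (fun x => v x - b x - D α W (x - a)) 2 MeasureTheory.volume ≤ tol α c ν

/-! ## STRENGTHEN — S⁺: the one-cycle trapping law (return-map form of the residue) -/

/-- **S⁺ `OneCycleTrap`.** For every small `ν` there is a nonempty class `𝒮` of (datum, global
Leray–Hopf solution) pairs, of energy `≤ K`, such that every member makes ONE debris visit at a good
time in `[0, L]` and RETURNS: at some good time `s ∈ [1, L]` the translated pair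
`(u s, u(· + s))` is again in `𝒮`. Iterating the return map along ONE member and the
window-energy bound give `RecurrentDebris` (window `2L`); conversely the crux's own solution, with
`𝒮 :=` its translates at good times, satisfies it (restart lemma
`Torus.IsGlobalLerayHopf.isGlobalLerayHopf_translate`, good times a.e. by `ae_energy_ineq_from`) —
so S⁺ is EQUIVALENT to the live residue `stub_debrisCycle` modulo proved lemmas. -/
def OneCycleTrap : Prop :=
  ∃ (α : ℝ) (W : E³ → E³) (f : 𝕋³ → E³) (M c L K ν₀ : ℝ), 2/3 < α ∧ α < 1 ∧ Adm α W ∧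
    Literature.Analysis.FunctionSpaces.Torus.IsSmooth f ∧ Literature.Analysis.FunctionSpaces.Torus.IsDivFree f ∧
    Literature.Analysis.FunctionSpaces.Torus.HasZeroMean f ∧ 0 < L ∧ 0 < ν₀ ∧
    ∀ ν : ℝ, 0 < ν → ν ≤ ν₀ →
      ∃ 𝒮 : Set ((𝕋³ → E³) × (ℝ → 𝕋³ → E³)), 𝒮.Nonempty ∧ ∀ p ∈ 𝒮,
        Literature.Analysis.FluidPDE.Torus.IsGlobalLerayHopf ν (fun _ => f) p.1 p.2 ∧
        Literature.Analysis.FunctionSpaces.Torus.kineticEnergy p.1 ≤ K ∧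
        (∃ t ∈ Set.Icc 0 L, Good ν f p.2 t ∧ IsDebrisState α W M c ν (p.2 t)) ∧
        ∃ s ∈ Set.Icc 1 L, Good ν f p.2 s ∧ (p.2 s, fun τ => p.2 (τ + s)) ∈ 𝒮

/-- **Window energy** (provable now; the only other ingredient of the S⁺-composition): over a window
of length `L` from a datum of energy `≤ K`, a global Leray–Hopf solution with steady smooth force has
energy `≤ E(f, L, K)`, uniformly in `ν > 0` (energy inequality from `0`, Cauchy–Schwarz on the work,
quadratic bootstrap; junk-safe since `KE (u 0) ≤ KE u₀`). -/
def WindowEnergy : Prop :=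
  ∀ (f : 𝕋³ → E³) (L K : ℝ), Literature.Analysis.FunctionSpaces.Torus.IsSmooth f → 0 < L →
    ∃ E : ℝ, ∀ (ν : ℝ) (u₀ : 𝕋³ → E³) (u : ℝ → 𝕋³ → E³), 0 < ν →
      Literature.Analysis.FluidPDE.Torus.IsGlobalLerayHopf ν (fun _ => f) u₀ u →
      Literature.Analysis.FunctionSpaces.Torus.kineticEnergy u₀ ≤ K →
      ∀ t ∈ Set.Icc 0 L, Literature.Analysis.FunctionSpaces.Torus.kineticEnergy (u t) ≤ E

/-- **S⁺⁺ `StableCycle`** (genuinely stronger: the class is OPEN in `L²` around a nonempty core and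
the law holds for EVERY Leray–Hopf solution from it — the shape of blow-up STABILITY theorems). -/
def StableCycle : Prop :=
  ∃ (α : ℝ) (W : E³ → E³) (f : 𝕋³ → E³) (M c L K ν₀ : ℝ), 2/3 < α ∧ α < 1 ∧ Adm α W ∧
    Literature.Analysis.FunctionSpaces.Torus.IsSmooth f ∧ Literature.Analysis.FunctionSpaces.Torus.IsDivFree f ∧
    Literature.Analysis.FunctionSpaces.Torus.HasZeroMean f ∧ 0 < L ∧ 0 < ν₀ ∧
    ∀ ν : ℝ, 0 < ν → ν ≤ ν₀ →
      ∃ (𝒞 : Set (𝕋³ → E³)) (ρ : ℝ), 0 < ρ ∧ 𝒞.Nonempty ∧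
        (∀ v ∈ 𝒞, MeasureTheory.MemLp v 2 MeasureTheory.volume ∧
          Literature.Analysis.FunctionSpaces.Torus.IsWeaklyDivFree v ∧
          Literature.Analysis.FunctionSpaces.Torus.kineticEnergy v ≤ K) ∧
        ∀ (v : 𝕋³ → E³) (u : ℝ → 𝕋³ → E³), MeasureTheory.MemLp v 2 MeasureTheory.volume →
          Literature.Analysis.FunctionSpaces.Torus.IsWeaklyDivFree v →
          (∃ v₀ ∈ 𝒞, MeasureTheory.eLpNorm (v - v₀) 2 MeasureTheory.volume < ENNReal.ofReal ρ) →
          Literature.Analysis.FluidPDE.Torus.IsGlobalLerayHopf ν (fun _ => f) v u →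
          (∃ t ∈ Set.Ioc 0 L, Good ν f u t ∧ IsDebrisState α W M c ν (u t)) ∧
          ∃ s ∈ Set.Icc 1 L, Good ν f u s ∧ u s ∈ 𝒞

/-! ## DECOMPOSITION — the best typed split: Formation ∣ Tracking ∣ Return (shared class `𝒞`) -/

/-- **F `Formation 𝒞 …`** — forced-Euler α-cusp blow-up on `T³` from every state of `𝒞`: a
classical solution of forced Euler (`ν = 0`) on `[0, T⋆)`, `T⋆ ≤ L`, whose `L²`-trace at the
singular time is EXACTLY a debris field `b + D(· − a)` (the surviving Bronzi–Shvydkoy scenario,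
profile `~|y|^{−α}` at infinity, realised with a smooth steady force, periodically, from a class). -/
def Formation (𝒞 : Set (𝕋³ → E³)) (α : ℝ) (W : E³ → E³) (f : 𝕋³ → E³) (M L : ℝ) : Prop :=
  ∀ v ∈ 𝒞, ∃ (T : ℝ) (u : ℝ → 𝕋³ → E³) (p : ℝ → 𝕋³ → ℝ) (a : 𝕋³) (b : 𝕋³ → E³),
    0 < T ∧ T ≤ L ∧ u 0 = v ∧ Bg M b ∧
    Literature.Analysis.FunctionSpaces.Torus.IsClassicalNSSolutionOn (Set.Ico 0 T) 0 (fun _ => f) u p ∧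
    Tendsto (fun t => MeasureTheory.eLpNorm (fun x => u t x - b x - D α W (x - a)) 2 MeasureTheory.volume)
      (𝓝[<] T) (𝓝 0)

/-- **V `Tracking 𝒞 …`** — quantitative inviscid limit THROUGH the collapse at the crux's tolerance:
every Leray–Hopf solution at small `ν` from a state of `𝒞` is, at some good time in `(0, L]`, a
debris state with tolerance `c·ν^{(3−2α)/(2(1−α))}` (heuristically FALSE at this tolerance: the
non-Lipschitz viscous sublayer defect is `~ν^{5/4} ≫ ν^{5/2}`; see the census, Negation N2). -/
def Tracking (𝒞 : Set (𝕋³ → E³)) (α : ℝ) (W : E³ → E³) (f : 𝕋³ → E³) (M c L ν₀ : ℝ) : Prop :=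
  ∀ ν : ℝ, 0 < ν → ν ≤ ν₀ → ∀ v ∈ 𝒞, ∀ u : ℝ → 𝕋³ → E³,
    Literature.Analysis.FluidPDE.Torus.IsGlobalLerayHopf ν (fun _ => f) v u →
    ∃ t ∈ Set.Ioc 0 L, Good ν f u t ∧ IsDebrisState α W M c ν (u t)

/-- **R `Return 𝒞 …`** — global forced-NS dynamics: from every debris state met at a good time, the
flow is back in `𝒞` (energy `≤ K`) at a good time within `[1, L]`. -/
def Return (𝒞 : Set (𝕋³ → E³)) (α : ℝ) (W : E³ → E³) (f : 𝕋³ → E³) (M c L K ν₀ : ℝ) : Prop :=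
  ∀ ν : ℝ, 0 < ν → ν ≤ ν₀ → ∀ (u₀ : 𝕋³ → E³) (u : ℝ → 𝕋³ → E³) (t : ℝ),
    Literature.Analysis.FluidPDE.Torus.IsGlobalLerayHopf ν (fun _ => f) u₀ u → 0 < t → Good ν f u t →
    IsDebrisState α W M c ν (u t) →
    ∃ s ∈ Set.Icc (t + 1) (t + L), Good ν f u s ∧ u s ∈ 𝒞 ∧
      Literature.Analysis.FunctionSpaces.Torus.kineticEnergy (u s) ≤ K

/-- The split as one statement: some class carries Formation ∧ Tracking ∧ Return (plus Hopf data in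
`𝒞`). `Tracking ∧ Return` alone already give `OneCycleTrap` (with `𝒮 :=` all Leray–Hopf pairs from
`𝒞`), hence the crux; `Formation` is what makes `Tracking` conceivable and is the Euler blow-up
problem in a strong periodic smooth-force form. -/
def FormationTrackingReturn : Prop :=
  ∃ (α : ℝ) (W : E³ → E³) (f : 𝕋³ → E³) (M c L K ν₀ : ℝ) (𝒞 : Set (𝕋³ → E³)),
    2/3 < α ∧ α < 1 ∧ Adm α W ∧ Literature.Analysis.FunctionSpaces.Torus.IsSmooth f ∧
    Literature.Analysis.FunctionSpaces.Torus.IsDivFree f ∧ Literature.Analysis.FunctionSpaces.Torus.HasZeroMean f ∧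
    1 < L ∧ 0 < ν₀ ∧ 𝒞.Nonempty ∧
    (∀ v ∈ 𝒞, MeasureTheory.MemLp v 2 MeasureTheory.volume ∧ Literature.Analysis.FunctionSpaces.Torus.IsWeaklyDivFree v ∧
      Literature.Analysis.FunctionSpaces.Torus.kineticEnergy v ≤ K) ∧
    Formation 𝒞 α W f M L ∧ Tracking 𝒞 α W f M c L ν₀ ∧ Return 𝒞 α W f M c L K ν₀

/-! ## NEGATION — typed obstructions (N1 provable now; N2 is the heuristic recorded in the census) -/

/-- **N1a `DebrisEnstrophyFloor`** (provable now; sharp Onsager-type bookkeeping): a field within `ε`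
in `L²` of `b + D(· − a)` (`b` calm of size `M`) has spectral enstrophy
`‖∇v‖₂² ≥ C₀ ε^{2(1−2α)/(3−2α)}` for `ε ≤ ε₀` — the Littlewood–Paley blocks of the exactly
homogeneous tip obey `‖Δ_j D‖₂ ≍ 2^{−j(3/2−α)}` for ALL large `j`, while `‖Δ_j v‖₂ ≲ 2^{−j}‖∇v‖₂`.
Negative exponent for `α > 1/2`: the floor blows up as `ε → 0`. -/
def DebrisEnstrophyFloor : Prop :=
  ∀ (α : ℝ) (W : E³ → E³) (M : ℝ), 1/2 < α → α < 3/2 → Adm α W →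
    ∃ C₀ ε₀ : ℝ, 0 < C₀ ∧ 0 < ε₀ ∧ ∀ ε : ℝ, 0 < ε → ε ≤ ε₀ →
      ∀ (v : 𝕋³ → E³) (a : 𝕋³) (b : 𝕋³ → E³), MeasureTheory.MemLp v 2 MeasureTheory.volume → Bg M b →
        MeasureTheory.eLpNorm (fun x => v x - b x - D α W (x - a)) 2 MeasureTheory.volume ≤ ENNReal.ofReal ε →
        ENNReal.ofReal (C₀ * ε ^ (2 * (1 - 2 * α) / (3 - 2 * α))) ≤
          Literature.Analysis.FunctionSpaces.Torus.eGradNormSq v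

/-- **N1b `NoSteadyDebrisWitness`** (provable now from N1a): for `2/3 < α < 1` no STEADY Leray–Hopf
solution at small viscosity is a debris state — with `ε = c ν^{(3−2α)/(2(1−α))}` the floor gives
`ν‖∇v‖₂² ≳ ν^{(2−3α)/(1−α)} → ∞`, against the steady energy balance `ν‖∇v‖₂² ≤ ‖f‖₂‖v‖₂`
(energy inequality from a.e. `s`, slices in `H¹` a.e.). Kills the Landau/steady-gluing approach to
the crux; `c ≤ 0` is covered since an `H¹` slice cannot equal the non-`H¹` field `b + D(·−a)`. -/
def NoSteadyDebrisWitness : Prop :=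
  ∀ (α : ℝ) (W : E³ → E³) (f : 𝕋³ → E³) (M c : ℝ), 2/3 < α → α < 1 → Adm α W →
    Literature.Analysis.FunctionSpaces.Torus.IsSmooth f →
    ∃ ν₁ : ℝ, 0 < ν₁ ∧ ∀ (ν : ℝ) (v u₀ : 𝕋³ → E³) (u : ℝ → 𝕋³ → E³), 0 < ν → ν ≤ ν₁ →
      Literature.Analysis.FluidPDE.Torus.IsGlobalLerayHopf ν (fun _ => f) u₀ u → (∀ t, 0 < t → u t = v) →
      ¬ IsDebrisState α W M c ν v

/-- **N1c `DebrisResidenceBound`** (provable now from N1a; the tightness lemma "visits are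
instantaneous"): along a global Leray–Hopf solution with energy `≤ E`, every measurable set of
times in `[0, T]` spent within tolerance of the debris manifold has measure
`≤ C₁ (T + 1) ν^{(3α−2)/(1−α)} → 0` — the energy inequality from a.e. `s > 0` bounds `ν∫₀ᵀ‖∇u‖²`
by `E + T‖f‖₂(2E)^{1/2}` (the lintegral is finite by `memL2Sobolev`), and on that set the floor N1a
applies at EVERY time (all slices are in `L²`). Stated for measurable subsets so that the
`lintegral` monotonicity is literal. -/
def DebrisResidenceBound : Prop :=
  ∀ (α : ℝ) (W : E³ → E³) (f : 𝕋³ → E³) (M c E : ℝ), 2/3 < α → α < 1 → Adm α W →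
    Literature.Analysis.FunctionSpaces.Torus.IsSmooth f →
    ∃ C₁ ν₁ : ℝ, 0 < ν₁ ∧ ∀ (ν : ℝ) (u₀ : 𝕋³ → E³) (u : ℝ → 𝕋³ → E³), 0 < ν → ν ≤ ν₁ →
      Literature.Analysis.FluidPDE.Torus.IsGlobalLerayHopf ν (fun _ => f) u₀ u →
      (∀ t, 0 ≤ t → Literature.Analysis.FunctionSpaces.Torus.kineticEnergy (u t) ≤ E) →
      ∀ (T : ℝ) (S : Set ℝ), 0 ≤ T → MeasurableSet S → S ⊆ Set.Icc 0 T →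
        (∀ t ∈ S, IsDebrisState α W M c ν (u t)) →
        MeasureTheory.volume S ≤ ENNReal.ofReal (C₁ * (T + 1) * ν ^ ((3 * α - 2) / (1 - α)))

/-! ## Sanity: the inline predicates agree with the route's (definitional unfolding) -/

example (α : ℝ) (W : E³ → E³) (M c ν : ℝ) (v : 𝕋³ → E³) :
    IsDebrisState α W M c ν v ↔ ∃ (a : 𝕋³) (b : 𝕋³ → E³), Bg M b ∧
      MeasureTheory.eLpNorm (fun x => v x - b x - D α W (x - a)) 2 MeasureTheory.volume ≤
        ENNReal.ofReal (c * ν ^ ((3 - 2 * α) / (2 * (1 - α)))) := Iff.rfl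

end Summit.AnomalousDissipation.AnomalousDissipation.Cruxes.RecurrentDebris.Strategist

end
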